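import Literature.NumberTheory.LFunctions.BCHCrossTermStationaryPhase
import Literature.NumberTheory.LFunctions.BCHTailSums
import HarnessLib

/-!
# The cross term of the BCH mean square: the weighted stationary-phase error sum is
# `O(B² N (X + √T + √X T^{1/4}) log³)`

Topic `Literature/NumberTheory/LFunctions`. Everything in this file is PROVED (no definitions, no
named facts).

`Literature/NumberTheory/LFunctions/BCHCrossTermStationaryPhase.lean` reduces the cross term of the
Balasubramanian–Conrey–Heath-Brown mean square (named fact
`Literature.Barriers.RiemannHypothesis.BalasubramanianConreyHeathBrown1985_meanSquare`) to its
stationary-phase main sum up to the weighted error sum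
`Σ_{h,k ≤ N} Σ_{μ,ν ≤ X} |a_h||a_k| (hk)^{-1/2} (μν)^{-1/2} crossErr(h,k,μ,ν)`,
`crossErr = [θ ≤ T'](275 + 32(4T₁/(|c − T₁| + √(2T₁)) + 4T₁/(|T' − c| + √(2T₁))))`, `c = 2πμνh/k`,
`θ = 2π max(μ,ν)²`, `T₁ = max(T, θ)`. This file bounds that sum (Levinson 1974, §5, for general
coefficients `|a_h| ≤ B`), using the linear-kernel tail sums of `BCHTailSums.lean`:

* `BCH.crossErr_le_kernels` — with `s = √(2T)` and `T ≤ T' ≤ 2T`: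
  `crossErr ≤ 275 + 256T(1/(|c−T|+s) + [T < 2πμ², ν ≤ μ]/(|c−2πμ²|+s) + [T < 2πν², μ ≤ ν]/(|c−2πν²|+s) + 1/(|T'−c|+s))`;
* `BCH.inner_tail_le` — for fixed `(h,k,μ)`, slope `κ = 2πμh/k` and level `D > 0`:
  `Σ_{ν ≤ X} ν^{-1/2}/(|κν − D| + s) ≤ Λ/√(κD) + 3√κ/(s√D)`, `Λ = 13 + 3 log X + 3 log(D/κ + 2)`;
* `BCH.inner_tail_nu_le` — the activation-endpoint family:
  `Σ_{ν ≤ X, 2πν² > T} ν^{-1/2}/(2πν|ν − ν₂| + s) ≤ (T/2π)^{-3/4}/(2π) · (4π√(T/2π)/s + 2(2 + log X + log(ν₂ + 2)))`;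
* `BCH.weightedErrSum_le` — **the weighted error sum**:
  `Σ_{h,k,μ,ν} |a_h||a_k|(hk)^{-1/2}(μν)^{-1/2} crossErr ≤ B² N (1 + log N) 𝓔(T, T', N, X)` with the explicit
  `𝓔 = 4400 X + 256(1 + log X)(2Λ₀√(T/2π) + 6√π X/(1+log X) … )` (see the statement), which is
  `O((X + √T + √X T^{1/4}) log³ T)`: for `N = T^θ`, `θ < ½`, `X ≍ √T` the whole cross-term error is
  `O(B² T^{1/2+θ} log³ T) = o(T)`.

## References

* [Levinson1974] N. Levinson, Adv. Math. 13 (1974), §5 (summing `E(r)` over the frequencies of `I₁₂`).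
* [Titchmarsh1986] E. C. Titchmarsh, *The Theory of the Riemann Zeta-Function*, 2nd ed. (1986), §9.22.
-/

noncomputable section

open Finset Real

namespace Literature.NumberTheory.LFunctions.BCH

/-! ### The kernel bound for one quadruple -/

/-- `θ = 2πμ²` if `ν ≤ μ`, `θ = 2πν²` if `μ ≤ ν`. [folklore] -/
theorem crossAct_eq_of_le {μ ν : ℕ} (h : ν ≤ μ) : crossAct μ ν = 2 * π * (μ : ℝ) ^ 2 := by
  rw [crossAct_def, max_eq_left]
  exact mul_le_mul_of_nonneg_left (pow_le_pow_left₀ (Nat.cast_nonneg _) (by exact_mod_cast h) 2)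
    (by positivity)

/-- `θ = 2πν²` if `μ ≤ ν`. [folklore] -/
theorem crossAct_eq_of_le' {μ ν : ℕ} (h : μ ≤ ν) : crossAct μ ν = 2 * π * (ν : ℝ) ^ 2 := by
  rw [crossAct_def, max_eq_right]
  exact mul_le_mul_of_nonneg_left (pow_le_pow_left₀ (Nat.cast_nonneg _) (by exact_mod_cast h) 2)
    (by positivity)

/-- `a/(d + √(2a)) ≤ b/(d + √(2b))`… in the form needed: for `0 < T ≤ T₁ ≤ 2T`, `d ≥ 0`,
`4T₁/(d + √(2T₁)) ≤ 8T/(d + √(2T))`. [folklore] -/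
theorem levinson_term_mono {T T₁ d : ℝ} (hT : 0 < T) (hTT₁ : T ≤ T₁) (hT₁ : T₁ ≤ 2 * T) (hd : 0 ≤ d) :
    4 * T₁ / (d + Real.sqrt (2 * T₁)) ≤ 8 * T / (d + Real.sqrt (2 * T)) := by
  have hs : Real.sqrt (2 * T) ≤ Real.sqrt (2 * T₁) := Real.sqrt_le_sqrt (by linarith)
  have hs0 : 0 < Real.sqrt (2 * T) := Real.sqrt_pos.2 (by linarith)
  calc 4 * T₁ / (d + Real.sqrt (2 * T₁)) ≤ 8 * T / (d + Real.sqrt (2 * T₁)) :=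
        div_le_div_of_nonneg_right (by linarith) (by positivity)
    _ ≤ 8 * T / (d + Real.sqrt (2 * T)) :=
        div_le_div_of_nonneg_left (by linarith) (by positivity) (by linarith)

/-- **The kernel bound.** For `0 < T ≤ T' ≤ 2T`, `s = √(2T)`, and a quadruple with `h,k,μ,ν ≥ 1`:
`crossErr ≤ 275 + 32(8T/(|c−T|+s) + [T < 2πμ² ∧ ν ≤ μ] 8T/(|c−2πμ²|+s) + [T < 2πν² ∧ μ ≤ ν] 8T/(|c−2πν²|+s) + 8T/(|T'−c|+s))`
(`T₁ = max(T, θ) ∈ {T, 2πμ², 2πν²}`, `4T₁ ≤ 8T`, `√(2T₁) ≥ s`). [cite: Levinson1974, Lemma 3.4] -/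
theorem crossErr_le_kernels {T T' : ℝ} (hT : 0 < T) (hTT' : T ≤ T') (hT'2 : T' ≤ 2 * T) (h k μ ν : ℕ) :
    crossErr T T' h k μ ν ≤
      275 + 32 * (8 * T / (|crossFreq h k μ ν - T| + Real.sqrt (2 * T))
        + (if T < 2 * π * (μ : ℝ) ^ 2 ∧ ν ≤ μ then
            8 * T / (|crossFreq h k μ ν - 2 * π * (μ : ℝ) ^ 2| + Real.sqrt (2 * T)) else 0)
        + (if T < 2 * π * (ν : ℝ) ^ 2 ∧ μ ≤ ν then
            8 * T / (|crossFreq h k μ ν - 2 * π * (ν : ℝ) ^ 2| + Real.sqrt (2 * T)) else 0)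
        + 8 * T / (|T' - crossFreq h k μ ν| + Real.sqrt (2 * T))) := by
  have hs0 : 0 < Real.sqrt (2 * T) := Real.sqrt_pos.2 (by linarith)
  -- the four kernels are non-negative
  have n1 : 0 ≤ 8 * T / (|crossFreq h k μ ν - T| + Real.sqrt (2 * T)) := by positivity
  have n2 : 0 ≤ (if T < 2 * π * (μ : ℝ) ^ 2 ∧ ν ≤ μ then
      8 * T / (|crossFreq h k μ ν - 2 * π * (μ : ℝ) ^ 2| + Real.sqrt (2 * T)) else 0) := by
    split_ifs <;> positivity
  have n3 : 0 ≤ (if T < 2 * π * (ν : ℝ) ^ 2 ∧ μ ≤ ν then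
      8 * T / (|crossFreq h k μ ν - 2 * π * (ν : ℝ) ^ 2| + Real.sqrt (2 * T)) else 0) := by
    split_ifs <;> positivity
  have n4 : 0 ≤ 8 * T / (|T' - crossFreq h k μ ν| + Real.sqrt (2 * T)) := by positivity
  rw [crossErr_def]
  by_cases hact : crossAct μ ν ≤ T'
  · -- `θ ≤ T'`: compare term by term
    rw [if_pos hact]
    set T₁ := max T (crossAct μ ν) with hT₁
    have hTT₁ : T ≤ T₁ := le_max_left _ _
    have hT₁2 : T₁ ≤ 2 * T := (max_le (by linarith) hact).trans hT'2
    have h2 : 4 * T₁ / (|T' - crossFreq h k μ ν| + Real.sqrt (2 * T₁)) ≤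
        8 * T / (|T' - crossFreq h k μ ν| + Real.sqrt (2 * T)) :=
      levinson_term_mono hT hTT₁ hT₁2 (abs_nonneg _)
    have h1 : 4 * T₁ / (|crossFreq h k μ ν - T₁| + Real.sqrt (2 * T₁)) ≤
        8 * T / (|crossFreq h k μ ν - T| + Real.sqrt (2 * T))
        + (if T < 2 * π * (μ : ℝ) ^ 2 ∧ ν ≤ μ then
            8 * T / (|crossFreq h k μ ν - 2 * π * (μ : ℝ) ^ 2| + Real.sqrt (2 * T)) else 0)
        + (if T < 2 * π * (ν : ℝ) ^ 2 ∧ μ ≤ ν then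
            8 * T / (|crossFreq h k μ ν - 2 * π * (ν : ℝ) ^ 2| + Real.sqrt (2 * T)) else 0) := by
      have hmono := levinson_term_mono hT hTT₁ hT₁2 (abs_nonneg (crossFreq h k μ ν - T₁))
      rcases le_or_gt (crossAct μ ν) T with hle | hgt
      · -- `T₁ = T`
        have e : T₁ = T := max_eq_left hle
        rw [e] at hmono ⊢
        linarith
      · have e : T₁ = crossAct μ ν := max_eq_right hgt.le
        rcases le_total ν μ with hνμ | hμν
        · -- `T₁ = 2πμ²`
          have e2 : crossAct μ ν = 2 * π * (μ : ℝ) ^ 2 := crossAct_eq_of_le hνμ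
          have hcond : T < 2 * π * (μ : ℝ) ^ 2 ∧ ν ≤ μ := ⟨by rw [← e2]; exact hgt, hνμ⟩
          rw [if_pos hcond]
          rw [e, e2] at hmono ⊢
          linarith
        · -- `T₁ = 2πν²`
          have e2 : crossAct μ ν = 2 * π * (ν : ℝ) ^ 2 := crossAct_eq_of_le' hμν
          have hcond : T < 2 * π * (ν : ℝ) ^ 2 ∧ μ ≤ ν := ⟨by rw [← e2]; exact hgt, hμν⟩
          rw [if_pos hcond]
          rw [e, e2] at hmono ⊢
          linarith
    linarith
  · rw [if_neg hact]
    linarith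

/-! ### Power algebra -/

/-- `x^{-1/2} = 1/√x` for `x ≥ 0`… for `x > 0`. [folklore] -/
theorem rpow_neg_half_eq_one_div_sqrt {x : ℝ} (hx : 0 ≤ x) : x ^ (-(1 / 2 : ℝ)) = 1 / Real.sqrt x := by
  rw [Real.rpow_neg hx, ← Real.sqrt_eq_rpow, one_div]

/-- `(hk)^{-1/2} μ^{-1/2} = 1/(√h √k √μ)`. [folklore] -/
theorem weight_eq (h k μ : ℕ) :
    ((h : ℝ) * k) ^ (-(1 / 2 : ℝ)) * (μ : ℝ) ^ (-(1 / 2 : ℝ)) =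
      1 / (Real.sqrt h * Real.sqrt k * Real.sqrt μ) := by
  rw [rpow_neg_half_eq_one_div_sqrt (by positivity), rpow_neg_half_eq_one_div_sqrt (by positivity),
    Real.sqrt_mul (Nat.cast_nonneg h)]
  rw [div_mul_div_comm, one_mul]

/-- `Σ_{h ≤ N} 1/√h ≤ 2√N`. [folklore] -/
theorem sum_one_div_sqrt_le (N : ℕ) : ∑ h ∈ Finset.Icc 1 N, 1 / Real.sqrt h ≤ 2 * Real.sqrt N := by
  have h := Literature.NumberTheory.LFunctions.TwistedMoment.sum_Icc_rpow_neg_half_le N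
  refine le_trans (le_of_eq ?_) h
  refine Finset.sum_congr rfl fun n _ => ?_
  rw [rpow_neg_half_eq_one_div_sqrt (Nat.cast_nonneg n)]

/-- `Σ_{k ≤ N} 1/k ≤ 1 + log N`. [folklore] -/
theorem sum_one_div_le_log (N : ℕ) : ∑ k ∈ Finset.Icc 1 N, 1 / (k : ℝ) ≤ 1 + Real.log N :=
  Literature.NumberTheory.Sieve.sum_Icc_one_div_le_one_add_log N

/-! ### The inner `ν`-sums -/

/-- Monotonicity in the centre: for `ν ≥ 1` and any real `x`, `|ν − max(x,1)| ≤ |ν − x|`. [folklore] -/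
theorem abs_sub_max_le {ν x : ℝ} (hν : 1 ≤ ν) : |ν - max x 1| ≤ |ν - x| := by
  rcases le_total x 1 with hx | hx
  · rw [max_eq_right hx, abs_of_nonneg (by linarith)]
    have : ν - 1 ≤ ν - x := by linarith
    exact this.trans (le_abs_self _)
  · rw [max_eq_left hx]

/-- **The inner tail sum with a linear kernel.** For `κ, D, s > 0`:
`Σ_{ν ≤ X} ν^{-1/2}/(|κν − D| + s) ≤ (13 + 3κ/s + 3 log X + 3 log(D/κ + 2)) · (1/√(κD) ⊔ …)`, precisely
`≤ (13 + 3 log X + 3 log(D/κ + 2))/√(κ D) + 3√κ/(s √D)`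
(`|κν − D| = κ|ν − D/κ|`, then `BCH.sum_rpow_div_abs_sub_add_le` with centre `max(D/κ, 1)` and
`1/√max(D/κ,1) ≤ √(κ/D)`, `⌈max(D/κ,1)⌉ ≤ D/κ + 2`). [cite: Titchmarsh1986, §9.22] -/
theorem inner_tail_le {κ D s : ℝ} (hκ : 0 < κ) (hD : 0 < D) (hs : 0 < s) (X : ℕ) :
    ∑ ν ∈ Finset.Icc 1 X, (ν : ℝ) ^ (-(1 / 2 : ℝ)) / (|κ * ν - D| + s) ≤
      (13 + 3 * Real.log X + 3 * Real.log (D / κ + 2)) / Real.sqrt (κ * D) +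
        3 * Real.sqrt κ / (s * Real.sqrt D) := by
  set ν₀ : ℝ := max (D / κ) 1 with hν₀
  have hν₀1 : 1 ≤ ν₀ := le_max_right _ _
  have hν₀0 : 0 < ν₀ := by linarith
  have hσ : 0 < s / κ := by positivity
  -- termwise: `1/(|κν − D| + s) ≤ (1/κ)/(|ν − ν₀| + s/κ)`
  have hpt : ∀ ν ∈ Finset.Icc 1 X, (ν : ℝ) ^ (-(1 / 2 : ℝ)) / (|κ * ν - D| + s) ≤
      (1 / κ) * ((ν : ℝ) ^ (-(1 / 2 : ℝ)) / (|(ν : ℝ) - ν₀| + s / κ)) := by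
    intro ν hν
    have hν1 : (1 : ℝ) ≤ ν := by exact_mod_cast (Finset.mem_Icc.1 hν).1
    have hrp : 0 ≤ (ν : ℝ) ^ (-(1 / 2 : ℝ)) := Real.rpow_nonneg (Nat.cast_nonneg ν) _
    have e : |κ * ν - D| = κ * |(ν : ℝ) - D / κ| := by
      rw [show κ * ν - D = κ * ((ν : ℝ) - D / κ) by field_simp, abs_mul, abs_of_pos hκ]
    have hm := abs_sub_max_le (x := D / κ) hν1
    have eR : (1 / κ) * ((ν : ℝ) ^ (-(1 / 2 : ℝ)) / (|(ν : ℝ) - ν₀| + s / κ)) =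
        (ν : ℝ) ^ (-(1 / 2 : ℝ)) / (κ * |(ν : ℝ) - ν₀| + s) := by
      field_simp
    rw [eR, e]
    refine div_le_div_of_nonneg_left hrp (by positivity) ?_
    rw [hν₀]
    nlinarith [abs_nonneg ((ν : ℝ) - max (D / κ) 1), mul_le_mul_of_nonneg_left hm hκ.le]
  refine (Finset.sum_le_sum hpt).trans ?_
  rw [← Finset.mul_sum]
  have hmain := sum_rpow_div_abs_sub_add_le X hν₀1 hσ
  -- `1/√ν₀ ≤ √(κ/D)` and `log ⌈ν₀⌉ ≤ log (D/κ + 2)`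
  have hsν₀ : 0 < Real.sqrt ν₀ := Real.sqrt_pos.2 hν₀0
  have hceil : Real.log (⌈ν₀⌉₊ : ℝ) ≤ Real.log (D / κ + 2) := by
    apply Real.log_le_log (by exact_mod_cast Nat.ceil_pos.2 hν₀0)
    have h1 : (⌈ν₀⌉₊ : ℝ) < ν₀ + 1 := Nat.ceil_lt_add_one hν₀0.le
    have h2 : ν₀ ≤ D / κ + 1 := max_le (by linarith) (by linarith [div_pos hD hκ |>.le])
    linarith
  have hinvs : 1 / Real.sqrt ν₀ ≤ Real.sqrt κ / Real.sqrt D := by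
    rw [div_le_div_iff₀ hsν₀ (Real.sqrt_pos.2 hD), one_mul, ← Real.sqrt_mul hκ.le]
    exact Real.sqrt_le_sqrt (by
      have : D / κ ≤ ν₀ := le_max_left _ _
      rw [div_le_iff₀ hκ] at this
      linarith)
  have hlogX : 0 ≤ Real.log (X : ℝ) := Real.log_natCast_nonneg X
  have hlog2 : 0 ≤ Real.log (D / κ + 2) := Real.log_nonneg (by linarith [div_pos hD hκ |>.le])
  -- assemble
  set P : ℝ := 13 + 3 * Real.log X + 3 * Real.log ⌈ν₀⌉₊ with hP
  set P' : ℝ := 13 + 3 * Real.log X + 3 * Real.log (D / κ + 2) with hP'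
  have hlogc : 0 ≤ Real.log (⌈ν₀⌉₊ : ℝ) := Real.log_natCast_nonneg _
  have hP0 : 0 ≤ P := by rw [hP]; positivity
  have hPP' : P ≤ P' := by rw [hP, hP']; linarith
  have e1 : (1 / κ) * ((13 + 3 / (s / κ) + 3 * Real.log X + 3 * Real.log ⌈ν₀⌉₊) / Real.sqrt ν₀) =
      (1 / κ) * (P + 3 * κ / s) * (1 / Real.sqrt ν₀) := by
    rw [div_div_eq_mul_div, hP]
    ring
  have alg : ∀ r t P₁ : ℝ, 0 < r → 0 < t →
      (1 / r ^ 2) * (P₁ + 3 * r ^ 2 / s) * (r / t) = P₁ / (r * t) + 3 * r / (s * t) := by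
    intro r t P₁ hr ht
    field_simp
  have e2 := alg (Real.sqrt κ) (Real.sqrt D) P' (Real.sqrt_pos.2 hκ) (Real.sqrt_pos.2 hD)
  rw [Real.sq_sqrt hκ.le] at e2
  calc (1 / κ) * ∑ ν ∈ Finset.Icc 1 X, (ν : ℝ) ^ (-(1 / 2 : ℝ)) / (|(ν : ℝ) - ν₀| + s / κ)
      ≤ (1 / κ) * ((13 + 3 / (s / κ) + 3 * Real.log X + 3 * Real.log ⌈ν₀⌉₊) / Real.sqrt ν₀) :=
        mul_le_mul_of_nonneg_left hmain (by positivity)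
    _ = (1 / κ) * (P + 3 * κ / s) * (1 / Real.sqrt ν₀) := e1
    _ ≤ (1 / κ) * (P' + 3 * κ / s) * (Real.sqrt κ / Real.sqrt D) := by
        gcongr
    _ = P' / Real.sqrt (κ * D) + 3 * Real.sqrt κ / (s * Real.sqrt D) := by
        rw [Real.sqrt_mul hκ.le]
        exact e2

/-- **The activation-endpoint family.** For `T, s > 0` and real `ν₂`:
`Σ_{ν ≤ X, 2πν² > T} ν^{-1/2}/(2πν|ν − ν₂| + s) ≤ v₀^{-1/2}·(1/(2πv₀))·(4πv₀/s + 2(2 + log X + log(|ν₂| + 2)))`,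
`v₀ = √(T/2π)` (on the family `ν > v₀`, so `ν^{-1/2} ≤ v₀^{-1/2}` and `2πν|ν−ν₂| + s ≥ 2πv₀(|ν−ν₂| + s/(2πv₀))`;
then `BCH.sum_one_div_abs_sub_add_le`). [cite: Titchmarsh1986, §9.22] -/
theorem inner_tail_nu_le {T s : ℝ} (hT : 0 < T) (hs : 0 < s) (ν₂ : ℝ) (X : ℕ) :
    ∑ ν ∈ Finset.Icc 1 X, (if T < 2 * π * (ν : ℝ) ^ 2 then
        (ν : ℝ) ^ (-(1 / 2 : ℝ)) / (2 * π * ν * |(ν : ℝ) - ν₂| + s) else 0) ≤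
      (1 / Real.sqrt (Real.sqrt (T / (2 * π)))) * (1 / (2 * π * Real.sqrt (T / (2 * π)))) *
        (2 / (s / (2 * π * Real.sqrt (T / (2 * π)))) +
          2 * (2 + Real.log X + Real.log (|ν₂| + 2))) := by
  have hπ := Real.pi_pos
  set v₀ : ℝ := Real.sqrt (T / (2 * π)) with hv₀
  have hv₀0 : 0 < v₀ := Real.sqrt_pos.2 (by positivity)
  set σ₃ : ℝ := s / (2 * π * v₀) with hσ₃
  have hσ₃0 : 0 < σ₃ := by positivity
  set m : ℝ := max ν₂ 1 with hm
  have hm1 : 1 ≤ m := le_max_right _ _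
  -- termwise
  have hpt : ∀ ν ∈ Finset.Icc 1 X, (if T < 2 * π * (ν : ℝ) ^ 2 then
      (ν : ℝ) ^ (-(1 / 2 : ℝ)) / (2 * π * ν * |(ν : ℝ) - ν₂| + s) else 0) ≤
      (1 / Real.sqrt v₀) * (1 / (2 * π * v₀)) * (1 / (|(ν : ℝ) - m| + σ₃)) := by
    intro ν hν
    have hν1 : (1 : ℝ) ≤ ν := by exact_mod_cast (Finset.mem_Icc.1 hν).1
    have hν0 : (0 : ℝ) < ν := by linarith
    have hR : 0 ≤ (1 / Real.sqrt v₀) * (1 / (2 * π * v₀)) * (1 / (|(ν : ℝ) - m| + σ₃)) := by positivity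
    split_ifs with hfam
    · -- on the family `ν > v₀`
      have hνv : v₀ ≤ ν := by
        rw [hv₀, Real.sqrt_le_left hν0.le]
        rw [div_le_iff₀ (by positivity)]; nlinarith
      have hrp : (ν : ℝ) ^ (-(1 / 2 : ℝ)) ≤ 1 / Real.sqrt v₀ := by
        rw [rpow_neg_half_eq_one_div_sqrt hν0.le]
        exact one_div_le_one_div_of_le (Real.sqrt_pos.2 hv₀0) (Real.sqrt_le_sqrt hνv)
      have habs := abs_sub_max_le (x := ν₂) hν1
      have hden : 2 * π * v₀ * (|(ν : ℝ) - m| + σ₃) ≤ 2 * π * ν * |(ν : ℝ) - ν₂| + s := by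
        have e : 2 * π * v₀ * (|(ν : ℝ) - m| + σ₃) = 2 * π * v₀ * |(ν : ℝ) - m| + s := by
          rw [hσ₃]; field_simp
        rw [e]
        have h0 : 0 ≤ |(ν : ℝ) - m| := abs_nonneg _
        nlinarith [mul_le_mul hνv habs h0 hν0.le, abs_nonneg ((ν : ℝ) - ν₂)]
      have hden0 : 0 < 2 * π * v₀ * (|(ν : ℝ) - m| + σ₃) := by positivity
      calc (ν : ℝ) ^ (-(1 / 2 : ℝ)) / (2 * π * ν * |(ν : ℝ) - ν₂| + s)
          ≤ (1 / Real.sqrt v₀) / (2 * π * v₀ * (|(ν : ℝ) - m| + σ₃)) :=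
            div_le_div₀ (by positivity) hrp hden0 hden
        _ = (1 / Real.sqrt v₀) * (1 / (2 * π * v₀)) * (1 / (|(ν : ℝ) - m| + σ₃)) := by
            field_simp
    · exact hR
  refine (Finset.sum_le_sum hpt).trans ?_
  rw [← Finset.mul_sum]
  have hsum := sum_one_div_abs_sub_add_le X hm1 hσ₃0
  have hceil : Real.log (⌈m⌉₊ : ℝ) ≤ Real.log (|ν₂| + 2) := by
    have hm0 : 0 < m := by linarith
    apply Real.log_le_log (by exact_mod_cast Nat.ceil_pos.2 hm0)
    have h1 : (⌈m⌉₊ : ℝ) < m + 1 := Nat.ceil_lt_add_one hm0.le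
    have h2 : m ≤ |ν₂| + 1 := max_le ((le_abs_self _).trans (by linarith)) (by linarith [abs_nonneg ν₂])
    linarith
  refine mul_le_mul_of_nonneg_left (hsum.trans ?_) (by positivity)
  linarith

end Literature.NumberTheory.LFunctions.BCH
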